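import Summits.Ventures.PercRepro.RankLevelSetRuleQTenCertDefs
/-!
# PercRepro — THE PARTIAL PRODUCTS OF THE UPPER CERTIFICATE OF THE FAMILY `k = 10` (p4, gen 25; C-044; paper §13.7): the four identities
`N^h·na + D^h·nb = P^h` (`h = A, B`; the lower and the upper convergent), each one `ring` with the short half-factor on the left.
No `sorry`; axioms standard.
-/

namespace PercRepro

set_option maxHeartbeats 6400000 in
set_option maxRecDepth 16384 in
/-- The partial product identity A of the upper certificate: `N_17^A·na + D_17^A·nb` in `(q, m)` — the short half-factor
(63 + 67 monomials) on the left of each product. -/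
lemma ten_upper_prodA (q m : ℚ) :
    cfSeventeenNA q m * naTen q m + cfSeventeenDA q m * nbTen q m = pUpperTenA q m := by
  unfold cfSeventeenNA cfSeventeenDA naTen nbTen pUpperTenA; ring

set_option maxHeartbeats 6400000 in
set_option maxRecDepth 16384 in
/-- The partial product identity B of the upper certificate: `N_17^B·na + D_17^B·nb` in `(q, m)` — the short half-factor
(63 + 68 monomials) on the left of each product. -/
lemma ten_upper_prodB (q m : ℚ) :
    cfSeventeenNB q m * naTen q m + cfSeventeenDB q m * nbTen q m = pUpperTenB q m := by
  unfold cfSeventeenNB cfSeventeenDB naTen nbTen pUpperTenB; ring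


end PercRepro
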